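import Literature.NumberTheory.Automorphic.HyperspecialUnitaryParabolicBlocks
import Literature.NumberTheory.Automorphic.HyperspecialUnitaryCartanUnique
import Literature.NumberTheory.Automorphic.CartanDecompositionGLn
import Literature.NumberTheory.Automorphic.CartanDecompositionGLnUnique
import Literature.NumberTheory.Automorphic.GLnTwoBlockLeviStructure
import HarnessLib

/-!
# Levi Cartan decomposition of `U(σ, J₀)`, I: blocks — sorted `GL_c` Cartan in the `Valued` currency, rigidity of block-diagonal unitary
# elements, and the blocks of a diagonal torus element (crux H413, U12-g ∕ 13a road A, item (B) `hcartanLevi`)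

Cell `hodgecm-mathlib`, Track B, line `K2_E3_EllipticInputs`, 13a road A; seat K2E3-p10 (g3) (road-A line lead).  THEOREMS ONLY (no `def`, no instance,
no notation, no `sorry`; count-neutral helper `--supports stmt-HodgeConjecture-24833 --as helper`).

The Levi `M_S` of the quasi-split unitary group `U(σ, J₀)` is `∏_b GL(V_b) × U(J₀^{(N′)})`.  Its Cartan decomposition (the `hcartanLevi(S)` input of ★
`K2E3WittLeviCuspidalDichotomyOfCartan`) is assembled in the sequel `K2E3WittLeviCartanUnramified` by peeling off the FIRST `GL` block with ★
`HermitianLattice.blockParabolic ∕ loBlockGL ∕ midBlockU ∕ blockDiagLift` (`HyperspecialUnitaryParabolicBlocks`).  This file supplies the three block tools: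

* §1 `exists_integral_mul_zpowDiagGL_antitone_mul` — the Cartan decomposition of `GL_c(K)` with SORTED exponents in the `Valued K ℤᵐ⁰` currency:
  `A = κ₁ · diag(ϖ^a) · κ₂`, `a` antitone, `κ₁, κ₂, κ₁⁻¹, κ₂⁻¹` integral (★ `exists_valuedCongruenceSubgroup_mul_mul_eq_diagonal` = Smith normal form, units
  split off, exponents sorted by a permutation matrix, ★ `permGL_mul_zpowDiagGL_mul_inv`).
* §2 RIGIDITY `eq_one_of_loBlock_midBlock` ∕ `eq_of_loBlockGL_eq_of_midBlockU_eq` — a unitary element which is block DIAGONAL for `[0,c) | [c,N−c) | [N−c,N)`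
  is determined by its first and middle blocks (the last block is forced by unitarity: the rows `rev i`, `i < c`, of `σ(w)ᵀ J₀ w = J₀`).
* §3 the blocks of a diagonal element `diag(ϖ^E)`: `loBlockGL = diag(ϖ^{E ∘ castLE})`, `midBlockU = diag(ϖ^{E ∘ midIndex})`, and its parabolic ∕ Levi
  memberships.

References: F. Bruhat, J. Tits (1972), (4.4.3); I. G. Macdonald (1995), Ch. V §2 (2.2); D. Bump (1997), Prop. 4.6.2; J. Rogawski (1990), §1.9–§1.10.
-/

set_option autoImplicit false
-- the mandated namespace repeats `HodgeConjecture.HodgeConjecture`, as in every `Theorems/*.lean` of this sub-problem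
set_option linter.dupNamespace false

noncomputable section

open scoped Valued WithZero Matrix MatrixGroups
open Matrix

namespace Summit.HodgeConjecture.HodgeConjecture.Cruxes.H413.K2E3WittLeviCartanBlocks

open Literature.NumberTheory.Automorphic Literature.NumberTheory.Automorphic.HermitianLattice
open Literature.NumberTheory.Automorphic.CartanUnique

variable {K : Type*} [Field K] [Valued K ℤᵐ⁰] {σ : K →+* K} {ϖ : K} {N c : ℕ}

/-! ## §1 Sorted Cartan decomposition of `GL_c(K)` in the `Valued` currency -/

/-- A diagonal matrix of units, and its inverse, have integral entries; it lies in `GL_c(𝒪) = valuedCongruenceSubgroup _ 1`.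
[cite: Macdonald1995, Ch. V §2 (2.2)] -/
theorem diagonalGL_mem_valuedCongruenceSubgroup_one {w : Fin c → Kˣ} (hw : ∀ i, Valued.v (w i : K) = 1) :
    (diagonalGL (Fin c) K w : GL (Fin c) K) ∈ valuedCongruenceSubgroup (Fin c) (1 : ℤᵐ⁰) := by
  have hle : ∀ i j, Valued.v ((diagonalGL (Fin c) K w : Matrix (Fin c) (Fin c) K) i j) ≤ 1 := fun i j => by
    rw [coe_diagonalGL, Matrix.diagonal_apply]
    split_ifs
    · rw [hw]
    · rw [map_zero]; exact zero_le_one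
  have hle' : ∀ i j, Valued.v ((((diagonalGL (Fin c) K w)⁻¹ : GL (Fin c) K) : Matrix (Fin c) (Fin c) K) i j) ≤ 1 := fun i j => by
    rw [← map_inv, coe_diagonalGL, Matrix.diagonal_apply]
    split_ifs
    · rw [Pi.inv_apply, Units.val_inv_eq_inv_val, map_inv₀, hw, inv_one]
    · rw [map_zero]; exact zero_le_one
  refine ⟨hle, hle', fun i j => ?_⟩
  rw [Matrix.sub_apply]
  refine Valuation.map_sub_le _ (hle i j) ?_
  rw [Matrix.one_apply]
  split_ifs <;> simp

/-- A permutation matrix lies in `GL_c(𝒪)`. [cite: Macdonald1995, Ch. V §2, before (2.2)] -/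
theorem permGL_mem_valuedCongruenceSubgroup_one (τ : Equiv.Perm (Fin c)) :
    (permGL τ : GL (Fin c) K) ∈ valuedCongruenceSubgroup (Fin c) (1 : ℤᵐ⁰) := by
  have hle : ∀ (ρ : Equiv.Perm (Fin c)) i j, Valued.v (((permGL ρ : GL (Fin c) K) : Matrix (Fin c) (Fin c) K) i j) ≤ 1 := fun ρ i j => by
    rw [coe_permGL]; exact v_permMatrix_apply_le_one ρ i j
  have hinv : ((permGL τ : GL (Fin c) K))⁻¹ = permGL τ⁻¹ := by
    refine inv_eq_of_mul_eq_one_right (Units.ext ?_)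
    rw [Units.val_mul, coe_permGL, coe_permGL, ← Matrix.permMatrix_mul, inv_mul_cancel, Matrix.permMatrix_one, Units.val_one]
  refine ⟨hle τ, fun i j => by rw [hinv]; exact hle τ⁻¹ i j, fun i j => ?_⟩
  rw [Matrix.sub_apply]
  refine Valuation.map_sub_le _ (hle τ i j) ?_
  rw [Matrix.one_apply]
  split_ifs <;> simp

/-- **SORTED CARTAN DECOMPOSITION OF `GL_c(K)`** (`Valued K ℤᵐ⁰`, `v ϖ = exp(-1)`, principal valuation ring): every `A ∈ GL_c(K)` is
`κ₁ · diag(ϖ^{a}) · κ₂` with `a : Fin c → ℤ` ANTITONE and `κ₁, κ₂ ∈ GL_c(𝒪)` (entries of `κ_i`, `κ_i⁻¹` integral).  Smith normal form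
(★ `exists_valuedCongruenceSubgroup_mul_mul_eq_diagonal`), units split off the diagonal, exponents sorted by a permutation matrix.
[cite: Macdonald1995, Ch. V §2 (2.2)] [cite: Bump1997, Prop. 4.6.2] -/
theorem exists_integral_mul_zpowDiagGL_antitone_mul [IsPrincipalIdealRing (Valued.v (R := K)).valuationSubring]
    (hϖ : Valued.v ϖ = WithZero.exp (-1 : ℤ)) (A : GL (Fin c) K) :
    ∃ κ₁ κ₂ : GL (Fin c) K, κ₁ ∈ valuedCongruenceSubgroup (Fin c) (1 : ℤᵐ⁰) ∧ κ₂ ∈ valuedCongruenceSubgroup (Fin c) (1 : ℤᵐ⁰) ∧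
      ∃ a : Fin c → ℤ, Antitone a ∧ A = κ₁ * zpowDiagGL (uniformizer_ne_zero hϖ) a * κ₂ := by
  have hϖ0 := uniformizer_ne_zero hϖ
  obtain ⟨k₁, hk₁, k₂, hk₂, d, hdiag⟩ := exists_valuedCongruenceSubgroup_mul_mul_eq_diagonal (Γ₀ := ℤᵐ⁰) A
  -- the diagonal entries are non-zero
  have hdet : (Matrix.diagonal d).det ≠ 0 := by
    rw [← hdiag]; exact ((k₁ * A * k₂ : GL (Fin c) K).isUnit.map Matrix.detMonoidHom).ne_zero
  have hd0 : ∀ i, d i ≠ 0 := fun i h0 => hdet (by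
    rw [Matrix.det_diagonal]; exact Finset.prod_eq_zero (Finset.mem_univ i) h0)
  choose e he using fun i => exists_v_eq_exp (hd0 i)
  obtain ⟨a₀, ha₀_def⟩ : ∃ a₀ : Fin c → ℤ, a₀ = fun i => -e i := ⟨_, rfl⟩
  have hw1 : ∀ i, Valued.v (d i * ϖ ^ e i) = 1 := fun i => v_mul_zpow_eq_one_of_v_eq_exp hϖ (he i)
  obtain ⟨w, hw_def⟩ : ∃ w : Fin c → Kˣ, w = fun i => Units.mk0 (d i * ϖ ^ e i) (ne_zero_of_v_eq_one (hw1 i)) := ⟨_, rfl⟩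
  have hwval : ∀ i, (w i : K) = d i * ϖ ^ e i := fun i => by rw [hw_def]; rfl
  have hw1' : ∀ i, Valued.v (w i : K) = 1 := fun i => by rw [hwval]; exact hw1 i
  have hD : k₁ * A * k₂ = diagonalGL (Fin c) K w * zpowDiagGL hϖ0 a₀ := by
    refine Units.ext ?_
    rw [hdiag, Units.val_mul, coe_diagonalGL, coe_zpowDiagGL, Matrix.diagonal_mul_diagonal]
    congr 1
    funext i
    rw [hwval, ha₀_def]
    dsimp only
    rw [mul_assoc, ← zpow_add₀ hϖ0, add_neg_cancel, zpow_zero, mul_one]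
  -- sort the exponents
  set τ : Equiv.Perm (Fin c) := Fin.revPerm.trans (Tuple.sort a₀) with hτ
  have hanti : Antitone (a₀ ∘ τ) := fun i j hij => by
    change a₀ (Tuple.sort a₀ (Fin.rev j)) ≤ a₀ (Tuple.sort a₀ (Fin.rev i))
    exact Tuple.monotone_sort a₀ (Fin.rev_le_rev.2 hij)
  have hT : zpowDiagGL hϖ0 a₀ = (permGL τ)⁻¹ * zpowDiagGL hϖ0 (a₀ ∘ τ) * permGL τ := by
    rw [← permGL_mul_zpowDiagGL_mul_inv hϖ0 τ a₀]; group
  refine ⟨k₁⁻¹ * diagonalGL (Fin c) K w * (permGL τ)⁻¹, permGL τ * k₂⁻¹,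
    Subgroup.mul_mem _ (Subgroup.mul_mem _ (Subgroup.inv_mem _ hk₁) (diagonalGL_mem_valuedCongruenceSubgroup_one hw1'))
      (Subgroup.inv_mem _ (permGL_mem_valuedCongruenceSubgroup_one τ)),
    Subgroup.mul_mem _ (permGL_mem_valuedCongruenceSubgroup_one τ) (Subgroup.inv_mem _ hk₂), a₀ ∘ τ, hanti, ?_⟩
  calc A = k₁⁻¹ * (k₁ * A * k₂) * k₂⁻¹ := by group
    _ = k₁⁻¹ * (diagonalGL (Fin c) K w * ((permGL τ)⁻¹ * zpowDiagGL hϖ0 (a₀ ∘ τ) * permGL τ)) * k₂⁻¹ := by rw [hD, hT]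
    _ = k₁⁻¹ * diagonalGL (Fin c) K w * (permGL τ)⁻¹ * zpowDiagGL hϖ0 (a₀ ∘ τ) * (permGL τ * k₂⁻¹) := by simp only [mul_assoc]

/-! ## §2 Rigidity of block-diagonal unitary elements -/

omit [Valued K ℤᵐ⁰] in
/-- **A block-diagonal unitary element with first block `1` and middle block `1` is `1`**: the last block is forced by unitarity — the
`(rev i, b)` entries of `σ(w)ᵀ J₀ w = J₀` for `i < c` read `w_{hiIndex i', b} = [b = hiIndex i']`. [cite: Rogawski1990, §1.9–§1.10] [cite: BruhatTits1972, (4.4.3)] -/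
theorem eq_one_of_loBlock_midBlock (hc : 2 * c ≤ N) (w : unitaryGroupOfForm σ ((StdForm.antidiagonal N).over K))
    (hwP : w ∈ blockParabolic σ N c) (hwP' : (w : GL (Fin N) K) ∈ standardParabolicGL K (OrderDual.toDual ∘ blockLabel N c))
    (hlo : ∀ i j : Fin c, ((w : GL (Fin N) K) : Matrix (Fin N) (Fin N) K) (Fin.castLE (le_of_two_mul_le hc) i) (Fin.castLE (le_of_two_mul_le hc) j) =
      (1 : Matrix (Fin c) (Fin c) K) i j)
    (hmid : ∀ i j : Fin (N - 2 * c), ((w : GL (Fin N) K) : Matrix (Fin N) (Fin N) K) (midIndex hc i) (midIndex hc j) =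
      (1 : Matrix (Fin (N - 2 * c)) (Fin (N - 2 * c)) K) i j) :
    w = 1 := by
  -- block diagonal: entries vanish off the diagonal blocks
  have hw : ∀ i j, blockLabel N c i ≠ blockLabel N c j → ((w : GL (Fin N) K) : Matrix (Fin N) (Fin N) K) i j = 0 := by
    intro i j hij
    rcases lt_or_gt_of_ne hij with h | h
    · exact hwP' (show (OrderDual.toDual ∘ blockLabel N c) j < (OrderDual.toDual ∘ blockLabel N c) i from OrderDual.toDual_lt_toDual.2 h)
    · exact hwP h
  set W : Matrix (Fin N) (Fin N) K := ((w : GL (Fin N) K) : Matrix (Fin N) (Fin N) K) with hW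
  -- the columns `castLE j` of `w` are the standard columns
  have hcol : ∀ (k : Fin N) (j : Fin c), W k (Fin.castLE (le_of_two_mul_le hc) j) =
      if k = Fin.castLE (le_of_two_mul_le hc) j then 1 else 0 := by
    intro k j
    obtain ⟨x, rfl⟩ := (blockSum hc).surjective k
    rcases x with (i | i) | i
    · rw [blockSum_inl_inl, hlo, Matrix.one_apply]
      by_cases h : i = j
      · rw [if_pos h, if_pos (by rw [h])]
      · rw [if_neg h, if_neg (fun h' => h (Fin.castLE_injective _ h'))]
    · rw [blockSum_inl_inr, hw _ _ (by rw [blockLabel_midIndex, blockLabel_castLE hc]; decide), if_neg]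
      intro h; have := congrArg (blockLabel N c) h; rw [blockLabel_midIndex, blockLabel_castLE hc] at this; exact absurd this (by decide)
    · rw [blockSum_inr, hw _ _ (by rw [blockLabel_hiIndex, blockLabel_castLE hc]; decide), if_neg]
      intro h; have := congrArg (blockLabel N c) h; rw [blockLabel_hiIndex, blockLabel_castLE hc] at this; exact absurd this (by decide)
  -- the rows `hiIndex i` of `w` are the standard rows (unitarity)
  have hrow : ∀ (i : Fin c) (b : Fin N), W (hiIndex hc i) b = if b = hiIndex hc i then 1 else 0 := by
    intro i b
    have hu := mem_unitaryGroupOfForm_iff.1 w.2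
    have h := congrFun (congrFun hu (Fin.castLE (le_of_two_mul_le hc) (Fin.rev i))) b
    rw [map_transpose_mul_antidiagonal_mul_apply, antidiagonal_over_apply, rev_castLE hc, Fin.rev_rev,
      Finset.sum_eq_single (Fin.castLE (le_of_two_mul_le hc) (Fin.rev i))] at h
    · rw [← hW, hcol, if_pos rfl, map_one, one_mul, rev_castLE hc, Fin.rev_rev] at h
      exact h
    · intro k _ hk
      rw [← hW, hcol, if_neg hk, map_zero, zero_mul]
    · intro h1; exact absurd (Finset.mem_univ _) h1
  refine Subtype.ext (Units.ext (Matrix.ext fun a b => ?_))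
  rw [OneMemClass.coe_one, Units.val_one, ← hW]
  obtain ⟨x, rfl⟩ := (blockSum hc).surjective a
  rcases x with (i | i) | i
  · rw [blockSum_inl_inl, Matrix.one_apply]
    by_cases hb : blockLabel N c b = 0
    · obtain ⟨y, rfl⟩ := (blockSum hc).surjective b
      rcases y with (j | j) | j
      · rw [blockSum_inl_inl, hlo, Matrix.one_apply]
        by_cases h : i = j
        · rw [if_pos h, if_pos (by rw [h])]
        · rw [if_neg h, if_neg (fun h' => h (Fin.castLE_injective _ h'))]
      · rw [blockSum_inl_inr, blockLabel_midIndex] at hb; exact absurd hb (by decide)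
      · rw [blockSum_inr, blockLabel_hiIndex] at hb; exact absurd hb (by decide)
    · rw [hw _ _ (by rw [blockLabel_castLE hc]; exact Ne.symm hb), if_neg]
      intro h; apply hb; rw [← h, blockLabel_castLE hc]
  · rw [blockSum_inl_inr, Matrix.one_apply]
    by_cases hb : blockLabel N c b = 1
    · obtain ⟨y, rfl⟩ := (blockSum hc).surjective b
      rcases y with (j | j) | j
      · rw [blockSum_inl_inl, blockLabel_castLE hc] at hb; exact absurd hb (by decide)
      · rw [blockSum_inl_inr, hmid, Matrix.one_apply]
        by_cases h : i = j
        · rw [if_pos h, if_pos (by rw [h])]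
        · rw [if_neg h, if_neg (fun h' => h (midIndex_injective hc h'))]
      · rw [blockSum_inr, blockLabel_hiIndex] at hb; exact absurd hb (by decide)
    · rw [hw _ _ (by rw [blockLabel_midIndex]; exact Ne.symm hb), if_neg]
      intro h; apply hb; rw [← h, blockLabel_midIndex]
  · rw [blockSum_inr, hrow, Matrix.one_apply]
    by_cases h : hiIndex hc i = b
    · rw [if_pos h, if_pos h.symm]
    · rw [if_neg h, if_neg (Ne.symm h)]

omit [Valued K ℤᵐ⁰] in
/-- **A block-diagonal unitary element is determined by its first and middle blocks** (`loBlockGL`, `midBlockU` of ★ `HyperspecialUnitaryParabolicBlocks`).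
[cite: Rogawski1990, §1.10] [cite: BruhatTits1972, (4.4.3)] -/
theorem eq_of_loBlockGL_eq_of_midBlockU_eq (hc : 2 * c ≤ N) {g h : unitaryGroupOfForm σ ((StdForm.antidiagonal N).over K)}
    (hgP : g ∈ blockParabolic σ N c) (hgP' : (g : GL (Fin N) K) ∈ standardParabolicGL K (OrderDual.toDual ∘ blockLabel N c))
    (hhP : h ∈ blockParabolic σ N c) (hhP' : (h : GL (Fin N) K) ∈ standardParabolicGL K (OrderDual.toDual ∘ blockLabel N c))
    (hlo : loBlockGL hc ⟨g, hgP⟩ = loBlockGL hc ⟨h, hhP⟩) (hmid : midBlockU hc ⟨g, hgP⟩ = midBlockU hc ⟨h, hhP⟩) : g = h := by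
  -- `w = g⁻¹ h` is block diagonal with trivial first and middle blocks
  have hw : g⁻¹ * h ∈ blockParabolic σ N c := Subgroup.mul_mem _ (Subgroup.inv_mem _ hgP) hhP
  have hw' : ((g⁻¹ * h : unitaryGroupOfForm σ ((StdForm.antidiagonal N).over K)) : GL (Fin N) K) ∈
      standardParabolicGL K (OrderDual.toDual ∘ blockLabel N c) := by
    rw [Subgroup.coe_mul, Subgroup.coe_inv]; exact Subgroup.mul_mem _ (Subgroup.inv_mem _ hgP') hhP'
  have hwP : (⟨g⁻¹ * h, hw⟩ : blockParabolic σ N c) = (⟨g, hgP⟩ : blockParabolic σ N c)⁻¹ * ⟨h, hhP⟩ := rfl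
  have hlo1 : loBlockGL hc ⟨g⁻¹ * h, hw⟩ = 1 := by rw [hwP, map_mul, map_inv, hlo, inv_mul_cancel]
  have hmid1 : midBlockU hc ⟨g⁻¹ * h, hw⟩ = 1 := by rw [hwP, map_mul, map_inv, hmid, inv_mul_cancel]
  have h1 : g⁻¹ * h = 1 := by
    refine eq_one_of_loBlock_midBlock hc (g⁻¹ * h) hw hw' (fun i j => ?_) (fun i j => ?_)
    · have := congrArg (fun x : GL (Fin c) K => (x : Matrix (Fin c) (Fin c) K) i j) hlo1
      simpa only [coe_loBlockGL, loBlock_apply, Units.val_one] using this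
    · have := congrArg (fun x : unitaryGroupOfForm σ ((StdForm.antidiagonal (N - 2 * c)).over K) =>
        ((x : GL (Fin (N - 2 * c)) K) : Matrix (Fin (N - 2 * c)) (Fin (N - 2 * c)) K) i j) hmid1
      simpa only [coe_midBlockU, midBlock_apply, OneMemClass.coe_one, Units.val_one] using this
  exact inv_mul_eq_one.1 h1

/-! ## §3 The blocks of a diagonal torus element -/

omit [Valued K ℤᵐ⁰] in
/-- A diagonal invertible matrix lies in every standard Levi subgroup. [cite: BruhatTits1972, (4.4.3)] -/
theorem diagonal_mem_standardLeviGL {α : Type*} [LinearOrder α] [Fintype α] (lab : Fin N → α) (g : GL (Fin N) K) {d : Fin N → K}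
    (hg : (g : Matrix (Fin N) (Fin N) K) = Matrix.diagonal d) : g ∈ standardLeviGL K lab := by
  rw [mem_standardLeviGL_iff]
  intro i j hij
  rw [hg, Matrix.diagonal_apply_ne _ (fun h => hij (congrArg lab h))]

omit [Valued K ℤᵐ⁰] in
/-- `diag(ϖ^E)` lies in every standard Levi subgroup (block diagonal for every labelling). [cite: BruhatTits1972, (4.4.3)] -/
theorem zpowDiagGL_mem_standardLeviGL {α : Type*} [LinearOrder α] [Fintype α] (lab : Fin N → α) (hϖ0 : ϖ ≠ 0) (E : Fin N → ℤ) :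
    (zpowDiagGL hϖ0 E : GL (Fin N) K) ∈ standardLeviGL K lab :=
  diagonal_mem_standardLeviGL lab _ (coe_zpowDiagGL hϖ0 E)

omit [Valued K ℤᵐ⁰] in
/-- `diag(ϖ^E)` lies in every standard parabolic subgroup (a diagonal matrix is block triangular for every labelling). [cite: BruhatTits1972, (4.4.3)] -/
theorem zpowDiagGL_mem_standardParabolicGL {α : Type*} [LinearOrder α] (lab : Fin N → α) (hϖ0 : ϖ ≠ 0) (E : Fin N → ℤ) :
    (zpowDiagGL hϖ0 E : GL (Fin N) K) ∈ standardParabolicGL K lab := by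
  rw [mem_standardParabolicGL_iff, coe_zpowDiagGL]; exact Matrix.blockTriangular_diagonal _

omit [Valued K ℤᵐ⁰] in
/-- `diag(ϖ^E) ∈ U(σ, J₀)` (`E ∘ rev = -E`, `σ ϖ = ϖ`) lies in the parabolic `Q_c`. [cite: BruhatTits1972, (4.4.3)] -/
theorem zpowDiagGL_mem_blockParabolic (hσϖ : σ ϖ = ϖ) (hϖ0 : ϖ ≠ 0) (hc : 2 * c ≤ N) {E : Fin N → ℤ} (hE : ∀ i, E (Fin.rev i) = -E i) :
    (⟨zpowDiagGL hϖ0 E, zpowDiagGL_mem_unitaryGroupOfForm hσϖ hϖ0 hE⟩ : unitaryGroupOfForm σ ((StdForm.antidiagonal N).over K)) ∈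
      blockParabolic σ N c := by
  have _ := hc
  rw [mem_blockParabolic_iff]
  change ((zpowDiagGL hϖ0 E : GL (Fin N) K) : Matrix (Fin N) (Fin N) K).BlockTriangular (blockLabel N c)
  rw [coe_zpowDiagGL]; exact Matrix.blockTriangular_diagonal _

omit [Valued K ℤᵐ⁰] in
/-- **The first block of `diag(ϖ^E)` is `diag(ϖ^{E ∘ castLE})`.** [cite: Rogawski1990, §1.10] -/
theorem loBlockGL_zpowDiagGL (hσϖ : σ ϖ = ϖ) (hϖ0 : ϖ ≠ 0) (hc : 2 * c ≤ N) {E : Fin N → ℤ} (hE : ∀ i, E (Fin.rev i) = -E i) :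
    loBlockGL hc ⟨⟨zpowDiagGL hϖ0 E, zpowDiagGL_mem_unitaryGroupOfForm hσϖ hϖ0 hE⟩, zpowDiagGL_mem_blockParabolic hσϖ hϖ0 hc hE⟩ =
      zpowDiagGL hϖ0 (E ∘ Fin.castLE (le_of_two_mul_le hc)) := by
  refine Units.ext (Matrix.ext fun i j => ?_)
  rw [coe_loBlockGL, loBlock_apply, coe_zpowDiagGL, coe_zpowDiagGL, Matrix.diagonal_apply, Matrix.diagonal_apply]
  by_cases h : i = j
  · subst h; rw [if_pos rfl, if_pos rfl]; rfl
  · rw [if_neg (fun h' => h (Fin.castLE_injective _ h')), if_neg h]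

omit [Valued K ℤᵐ⁰] in
/-- **The middle block of `diag(ϖ^E)` is `diag(ϖ^{E ∘ midIndex})`** (as an element of `U(σ, J₀^{(N-2c)})`; compared on matrices).
[cite: Rogawski1990, §1.10] -/
theorem coe_midBlockU_zpowDiagGL (hσϖ : σ ϖ = ϖ) (hϖ0 : ϖ ≠ 0) (hc : 2 * c ≤ N) {E : Fin N → ℤ} (hE : ∀ i, E (Fin.rev i) = -E i) :
    ((midBlockU hc ⟨⟨zpowDiagGL hϖ0 E, zpowDiagGL_mem_unitaryGroupOfForm hσϖ hϖ0 hE⟩, zpowDiagGL_mem_blockParabolic hσϖ hϖ0 hc hE⟩ :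
        GL (Fin (N - 2 * c)) K) : Matrix (Fin (N - 2 * c)) (Fin (N - 2 * c)) K) =
      Matrix.diagonal fun j => ϖ ^ E (midIndex hc j) := by
  ext i j
  rw [coe_midBlockU, midBlock_apply, coe_zpowDiagGL, Matrix.diagonal_apply, Matrix.diagonal_apply]
  by_cases h : i = j
  · subst h; rw [if_pos rfl, if_pos rfl]
  · rw [if_neg (fun h' => h (midIndex_injective hc h')), if_neg h]

/-- The exponents of the middle block are again antisymmetric: `E (midIndex (rev j)) = -E (midIndex j)` (`rev ∘ midIndex = midIndex ∘ rev`).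
[cite: BruhatTits1972, (4.4.3)] -/
theorem midIndex_exponent_rev (hc : 2 * c ≤ N) {E : Fin N → ℤ} (hE : ∀ i, E (Fin.rev i) = -E i) (j : Fin (N - 2 * c)) :
    E (midIndex hc (Fin.rev j)) = -E (midIndex hc j) := by
  rw [← rev_midIndex hc, hE]

end Summit.HodgeConjecture.HodgeConjecture.Cruxes.H413.K2E3WittLeviCartanBlocks

end
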